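import Literature.Barriers.HodgeConjecture.KaehlerCounterexamplesJTorus
import Literature.Geometry.Kaehler.ComplexTorusCoordForms
import Literature.AlgebraicTopology.SingularHomology.UniversalCoefficientsField
import Literature.AlgebraicTopology.SingularHomology.BettiNumberBaseChange
import Literature.AlgebraicTopology.SingularHomology.CohomologyFiniteness
import HarnessLib

/-!
# Rational classes on a complex torus are proportional to rational invariant forms

Fourth file of the discharge programme of the barrier fact
`Literature.Barriers.HodgeConjecture.Voisin2002_weilTorus_hodgeClassWithoutSubvarieties`
(`KaehlerCoherentSheaves.lean`; programme in `KaehlerCoherentSheavesProofs.lean`), serving its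
clause (a) (`NS(X) = 0` as the absence of non-zero integral `(1,1)`-classes). Let
`X = E/Φ(ℤ^ι)` be a complex torus (`ComplexTorus Φ`, `Φ : ℝ^ι ≃ E` a period isomorphism) and
`e` ANY natural complex de Rham comparison family (`ComplexDeRhamIsoFamily.IsNatural`; de Rham's
theorem provides one). Every class of `H²(X; ℂ)` is `e[γ]` for a unique invariant form
`γ ∈ Alt²_ℝ(E; ℂ)` (Lange–Birkenhake (1992), Prop. 1.1.20, tree `ComplexTorus.cconstClassEquiv`),
and `Alt²_ℝ(E; ℂ)` has the basis of lattice-coordinate forms `ε_{ab} = dxₐ ∧ dx_b`, `a < b`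
(tree `ComplexTorus.coordFormBasis`), whose `ℚ`-span is the space of **rational invariant
forms** (those with rational values on the lattice basis `Φ(ℤ^ι)`). We PROVE:

* `exists_smul_mem_span_coordForm_of_isRationalClass`: **if `e[γ]` is a rational class
  (`IsRationalClass`) then `γ = g · γ₀` for a complex number `g` and a RATIONAL invariant form
  `γ₀`.** (Lange–Birkenhake §1.1.4 / Prop. 1.3.? in substance: under the de Rham isomorphism
  `H²(X, ℚ) ⊗ ℂ = Alt²_ℝ(V; ℂ)` with `H²(X, ℚ) = Alt²(Λ, ℚ)`; here WITHOUT the Künneth computation of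
  `H^*(X; ℤ)` and for an un-normalised comparison family, whence the scalar `g`.)

## Proof (naturality + universal coefficients, no Künneth)

Let `R = {γ : e[γ] rational}`, a `ℚ`-subspace of `Alt²_ℝ(E; ℂ)`. (1) `R` is stable under
`γ ↦ γ ∘ ρ(B)` for every integer matrix `B` (`ρ(B) = Φ B Φ⁻¹` the analytic representation of the
real-smooth endomorphism `mapMatrix B` of `X`): `e` is natural and pull-backs preserve rational
classes (`isRationalClass_cconstClass_comp_realRep`). (2) If `γ ≠ 0`, some lattice coordinate
`g = γ(Φeₐ, Φe_b)`, `a < b`, is non-zero, and for every pair `c < d` the rank-`2` integer matrix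
`B` with `Be_c = eₐ`, `Be_d = e_b`, `Be_k = 0` otherwise has `γ ∘ ρ(B) = g · ε_{cd}`
(`comp_realRep_elementary`); so all `g · ε_{cd}` lie in `R`. (3) `dim_ℚ` of the rational classes
is at most `dim_ℚ H²(X; ℚ) = b₂(X; ℚ) = b₂(X; ℂ) = dim_ℂ H²(X; ℂ) = dim_ℂ Alt²_ℝ(E; ℂ) = #{c < d}`
(universal coefficients over the fields `ℚ`, `ℂ`, base change of Betti numbers, the isomorphism
`e_X` and the basis `ε`; `finrank_singularCohomology_rat_complexTorus_two`), and the classes of the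
`g · ε_{cd}` are `ℚ`-linearly independent (they are `ℂ`-independent); hence they span the rational
classes over `ℚ`, and `e[γ] = ∑ q_{cd} e[g ε_{cd}]`, i.e. `γ = g · ∑ q_{cd} ε_{cd}`. The
`ℚ`-structure of `Hᵏ(X; ℂ)` is handled on cocycles (`cocycleOfRat`, `π_cocycleOfRat_eq_iff` of
`HodgeTheory/RationalLattice`).

No definition and no named fact is introduced.

## References

* H. Lange, Ch. Birkenhake, *Complex Abelian Varieties* (1992), §1.1.2 (rational and analytic
  representations), §1.1.4 Prop. 1.1.20. [LangeBirkenhake1992]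
* A. Hatcher, *Algebraic Topology* (2002), §3.1 Thm. 3.2 and p. 198; §3.A Thm. 3A.3; App. A
  Cor. A.8–A.9. [HatcherAT2002]
* C. Voisin, IMRN 2002 no. 20 (arXiv:math/0112247), §2 (a) `NS(X) = 0`, §3 Prop. 3.
  [Voisin2002KaehlerCounterexample]
-/

noncomputable section

open scoped Manifold ContDiff Topology

namespace Literature.Barriers.HodgeConjecture

open Literature.AlgebraicGeometry.HodgeTheory Literature.AlgebraicTopology.SingularHomology
  Literature.NumberTheory.Transcendental Literature.Geometry.Kaehler singularCochainComplex

section RationalForms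

variable {ι : Type} [LinearOrder ι] [Fintype ι]
variable {E : Type} [NormedAddCommGroup E] [NormedSpace ℂ E] [FiniteDimensional ℂ E]
variable (Φ : (ι → ℝ) ≃L[ℝ] E)

/-! ### Naturality: rational classes of invariant forms are stable under the integer matrices -/

omit [LinearOrder ι] [FiniteDimensional ℂ E] in
/-- `(mapMatrix B)^* [constForm Φ c] = [constForm Φ (c ∘ ρ(B))]` in `H^k_dR(X; ℂ)` for an
endomorphism `mapMatrix B` of the torus `X = E/Φ(ℤ^ι)` (Lange–Birkenhake (1992), §1.1.2/§1.1.4).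
[cite: LangeBirkenhake1992, §1.1.4] -/
theorem cmap_cconstClass_mapMatrix_self (B : Matrix ι ι ℤ) {k : ℕ} (c : E [⋀^Fin k]→L[ℝ] ℂ) :
    complexDeRhamCohomology.map E
        (ComplexTorus.contMDiff_real_mapMatrix (Φ := Φ) (Φ' := Φ) (n := ∞) B) k
        (ComplexTorus.cconstClass Φ c) =
      ComplexTorus.cconstClass Φ (c.compContinuousLinearMap (ComplexTorus.realRep Φ Φ B)) := by
  rw [ComplexTorus.cconstClass_apply, complexDeRhamCohomology.map_mk,
    ComplexTorus.cconstClass_apply]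
  congr 1
  exact Subtype.ext (ComplexTorus.pullback_constForm_mapMatrix (Φ := Φ) (Φ' := Φ) B c)

omit [LinearOrder ι] [FiniteDimensional ℂ E] in
/-- **Rational classes of invariant forms are stable under the integer matrices**: if `e[γ]` is a
rational class then so is `e[γ ∘ ρ(B)] = (mapMatrix B)^* e[γ]` for every integer matrix `B`
(naturality of `e`; pull-backs preserve rational classes). [cite: LangeBirkenhake1992, §1.1.2] -/
theorem isRationalClass_cconstClass_comp_realRep {e : ComplexDeRhamIsoFamily E} (he : e.IsNatural)
    (B : Matrix ι ι ℤ) {k : ℕ} {γ : E [⋀^Fin k]→L[ℝ] ℂ}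
    (hγ : IsRationalClass (e (ComplexTorus Φ) k (ComplexTorus.cconstClass Φ γ))) :
    IsRationalClass (e (ComplexTorus Φ) k
      (ComplexTorus.cconstClass Φ (γ.compContinuousLinearMap (ComplexTorus.realRep Φ Φ B)))) := by
  have hF := ComplexTorus.contMDiff_real_mapMatrix (Φ := Φ) (Φ' := Φ) (n := ∞) B
  rw [← cmap_cconstClass_mapMatrix_self Φ B γ, he _ _ _ hF k]
  exact hγ.map _

/-! ### Rank-two integer matrices move every lattice coordinate of `γ` onto every `ε_{cd}` -/

omit [FiniteDimensional ℂ E] in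
/-- **The elementary computation**: for `a, b` and a pair `c < d`, the integer matrix `B` with
`Be_c = eₐ`, `Be_d = e_b` and `Be_k = 0` otherwise satisfies `γ ∘ ρ(B) = γ(Φeₐ, Φe_b) · ε_{cd}`.
[cite: LangeBirkenhake1992, §1.1.2] -/
theorem comp_realRep_elementary (γ : E [⋀^Fin 2]→L[ℝ] ℂ) (p : ComplexTorus.Pairs ι) (a b : ι) :
    γ.compContinuousLinearMap (ComplexTorus.realRep Φ Φ (Matrix.of fun i j ↦
        if j = p.1.1 then (if i = a then (1 : ℤ) else 0)
        else if j = p.1.2 then (if i = b then 1 else 0) else 0)) =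
      γ ![Φ (Pi.single a 1), Φ (Pi.single b 1)] • ComplexTorus.coordForm Φ p.1.1 p.1.2 := by
  set B : Matrix ι ι ℤ := Matrix.of fun i j ↦
    if j = p.1.1 then (if i = a then (1 : ℤ) else 0)
    else if j = p.1.2 then (if i = b then 1 else 0) else 0 with hB
  have hp : p.1.1 ≠ p.1.2 := ne_of_lt p.2
  have hcol : ∀ k : ι, ComplexTorus.realRep Φ Φ B (Φ (Pi.single k 1)) =
      if k = p.1.1 then Φ (Pi.single a 1) else if k = p.1.2 then Φ (Pi.single b 1) else 0 := by
    intro k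
    rw [ComplexTorus.realRep_apply, Matrix.mulVec_single_one]
    have hc : (B.map (Int.cast : ℤ → ℝ)).col k =
        if k = p.1.1 then Pi.single a 1 else if k = p.1.2 then Pi.single b 1 else 0 := by
      funext i
      simp only [Matrix.col_apply, Matrix.map_apply, hB, Matrix.of_apply]
      by_cases h1 : k = p.1.1
      · subst h1
        simp [Pi.single_apply, eq_comm]
      · by_cases h2 : k = p.1.2
        · subst h2
          simp [h1, Pi.single_apply, eq_comm]
        · simp [h1, h2]
    rw [hc]
    split_ifs <;> simp
  refine (ComplexTorus.coordFormBasis Φ).ext_elem fun q ↦ ?_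
  rw [ComplexTorus.coordFormBasis_repr, map_smul, Finsupp.smul_apply,
    ← ComplexTorus.coordFormBasis_apply, Module.Basis.repr_self, smul_eq_mul,
    ContinuousAlternatingMap.compContinuousLinearMap_apply]
  have hv : (ComplexTorus.realRep Φ Φ B ∘ ![Φ (Pi.single q.1.1 1), Φ (Pi.single q.1.2 1)]) =
      ![ComplexTorus.realRep Φ Φ B (Φ (Pi.single q.1.1 1)),
        ComplexTorus.realRep Φ Φ B (Φ (Pi.single q.1.2 1))] := by
    funext i; fin_cases i <;> rfl
  rw [hv, hcol, hcol]
  have hq : q.1.1 ≠ q.1.2 := ne_of_lt q.2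
  by_cases hqp : q = p
  · subst hqp
    simp [hp.symm]
  · rw [Finsupp.single_apply, if_neg (Ne.symm hqp), mul_zero]
    -- one of the two arguments vanishes
    by_cases h1 : q.1.1 = p.1.1
    · have h2 : q.1.2 ≠ p.1.2 := fun h2 ↦ hqp (Subtype.ext (Prod.ext h1 h2))
      have h3 : q.1.2 ≠ p.1.1 := fun h3 ↦ hq (h1.trans h3.symm)
      rw [if_pos h1, if_neg h3, if_neg h2]
      exact γ.map_coord_zero 1 rfl
    · by_cases h2 : q.1.1 = p.1.2
      · have h3 : q.1.2 ≠ p.1.1 := fun h3 ↦ by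
          have := q.2; rw [h2, h3] at this; exact absurd (p.2.trans this) (lt_irrefl _)
        have h4 : q.1.2 ≠ p.1.2 := fun h4 ↦ hq (h2.trans h4.symm)
        rw [if_neg h1, if_pos h2, if_neg h3, if_neg h4]
        exact γ.map_coord_zero 1 rfl
      · rw [if_neg h1, if_neg h2]
        exact γ.map_coord_zero 0 rfl

/-! ### Universal coefficients: `dim_ℚ H²(X; ℚ) = #{a < b}` -/

omit [LinearOrder ι] in
/-- **The rational cohomology of a complex torus is finite-dimensional** (a compact Hausdorff
manifold charted on `E ≃ ℝ^{dim E}`; Hatcher (2002), App. A Cor. A.8–A.9 with §3.1 Cor. 3.3, tree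
`finite_singularCohomology_of_compact_chartedSpace`). [cite: HatcherAT2002, App. A Cor. A.8–A.9 and §3.1 Cor. 3.3] -/
theorem finite_singularCohomology_rat_complexTorus (k : ℕ) :
    Module.Finite ℚ (singularCohomology ℚ ℚ (ComplexTorus Φ) k) := by
  let eC : E ≃ₜ EuclideanSpace ℝ (Fin (Module.finrank ℝ E)) :=
    (ContinuousLinearEquiv.ofFinrankEq (𝕜 := ℝ) (by rw [finrank_euclideanSpace_fin])).toHomeomorph
  letI : ChartedSpace (EuclideanSpace ℝ (Fin (Module.finrank ℝ E))) (ComplexTorus Φ) :=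
    { atlas := Set.range fun P : ComplexTorus Φ ↦ (chartAt E P).transHomeomorph eC
      chartAt := fun P ↦ (chartAt E P).transHomeomorph eC
      mem_chart_source := fun P ↦ by
        rw [OpenPartialHomeomorph.transHomeomorph_source]; exact mem_chart_source _ P
      chart_mem_atlas := fun P ↦ ⟨P, rfl⟩ }
  exact finite_singularCohomology_of_compact_chartedSpace (R := ℚ) ℚ (d := Module.finrank ℝ E) k

/-- **`dim_ℚ H²(X; ℚ) = #{a < b}` for the complex torus `X = E/Φ(ℤ^ι)`**, through any complex
de Rham comparison family `e`: `dim_ℚ H²(X; ℚ) = b₂(X; ℚ) = b₂(X; ℂ) = dim_ℂ H²(X; ℂ)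
= dim_ℂ H²_dR(X; ℂ) = dim_ℂ Alt²_ℝ(E; ℂ) = #{a < b}` (universal coefficients over `ℚ` and `ℂ`,
Hatcher Thm. 3.2 / 3A.3; the isomorphism `e_X`; Lange–Birkenhake Prop. 1.1.20 and the basis
`ε_{ab}`). [cite: HatcherAT2002, §3.1 Thm. 3.2 and §3.A Thm. 3A.3] [cite: LangeBirkenhake1992, Prop. 1.1.20] -/
theorem finrank_singularCohomology_rat_complexTorus_two (e : ComplexDeRhamIsoFamily E) :
    Module.finrank ℚ (singularCohomology ℚ ℚ (ComplexTorus Φ) 2) =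
      Fintype.card (ComplexTorus.Pairs ι) := by
  rw [finrank_singularCohomology_eq_bettiNumber_of_field ℚ (ComplexTorus Φ) 2,
    bettiNumber_rat_eq_real, bettiNumber_real_eq_complex,
    ← finrank_singularCohomology_eq_bettiNumber_of_field ℂ (ComplexTorus Φ) 2,
    ← (e (ComplexTorus Φ) 2).finrank_eq, ← (ComplexTorus.cconstClassEquiv Φ (k := 2)).finrank_eq,
    Module.finrank_eq_card_basis (ComplexTorus.coordFormBasis Φ)]

/-! ### The theorem -/

/-- **Rational classes of a complex torus are proportional to rational invariant forms.** For the
torus `X = E/Φ(ℤ^ι)`, any natural complex de Rham comparison family `e` and `γ ∈ Alt²_ℝ(E; ℂ)`: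
if the class `e[constForm γ] ∈ H²(X; ℂ)` is rational, then `γ = g · γ₀` with `g ∈ ℂ` and `γ₀` in
the `ℚ`-span of the lattice-coordinate forms `ε_{ab}` (i.e. `γ₀` takes rational values on the
lattice basis). [cite: LangeBirkenhake1992, §1.1.4 Prop. 1.1.20] [cite: HatcherAT2002, §3.1 Thm. 3.2 and p. 198] -/
theorem exists_smul_mem_span_coordForm_of_isRationalClass {e : ComplexDeRhamIsoFamily E}
    (he : e.IsNatural) (γ : E [⋀^Fin 2]→L[ℝ] ℂ)
    (hγ : IsRationalClass (e (ComplexTorus Φ) 2 (ComplexTorus.cconstClass Φ γ))) :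
    ∃ (g : ℂ) (γ₀ : E [⋀^Fin 2]→L[ℝ] ℂ),
      γ₀ ∈ Submodule.span ℚ (Set.range fun p : ComplexTorus.Pairs ι ↦
        ComplexTorus.coordForm Φ p.1.1 p.1.2) ∧ γ = g • γ₀ := by
  classical
  by_cases hγ0 : γ = 0
  · exact ⟨0, 0, Submodule.zero_mem _, by rw [hγ0]; ext v; simp⟩
  -- the injective linear map `L γ = e[constForm γ]`
  set L : (E [⋀^Fin 2]→L[ℝ] ℂ) →ₗ[ℂ] singularCohomology ℂ ℂ (ComplexTorus Φ) 2 :=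
    (e (ComplexTorus Φ) 2).toLinearMap ∘ₗ ComplexTorus.cconstClass Φ with hL
  have hLapply : ∀ δ, L δ = e (ComplexTorus Φ) 2 (ComplexTorus.cconstClass Φ δ) := fun δ ↦ rfl
  have hLinj : Function.Injective L :=
    (e (ComplexTorus Φ) 2).injective.comp (ComplexTorus.cconstClassEquiv Φ (k := 2)).injective
  -- (2) a non-zero lattice coordinate `g`
  obtain ⟨p₀, hp₀⟩ : ∃ p₀ : ComplexTorus.Pairs ι, (ComplexTorus.coordFormBasis Φ).repr γ p₀ ≠ 0 := by
    by_contra h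
    push Not at h
    exact hγ0 ((ComplexTorus.coordFormBasis Φ).repr.map_eq_zero_iff.1 (Finsupp.ext h))
  set g : ℂ := γ ![Φ (Pi.single p₀.1.1 1), Φ (Pi.single p₀.1.2 1)] with hg
  have hg0 : g ≠ 0 := by rwa [hg, ← ComplexTorus.coordFormBasis_repr]
  -- all `g ε_p` have rational classes
  have hrat : ∀ p : ComplexTorus.Pairs ι,
      IsRationalClass (L (g • ComplexTorus.coordForm Φ p.1.1 p.1.2)) := fun p ↦ by
    rw [hLapply, ← comp_realRep_elementary Φ γ p p₀.1.1 p₀.1.2]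
    exact isRationalClass_cconstClass_comp_realRep Φ he _ hγ
  -- (3) rational cocycle representatives
  choose ζ hζ using fun p ↦ (hrat p).exists_cocycleOfRat
  obtain ⟨ζγ, hζγ⟩ := hγ.exists_cocycleOfRat
  -- the `ℚ`-linear algebra in `H²(X; ℚ)`
  set z : ComplexTorus.Pairs ι → singularCohomology ℚ ℚ (ComplexTorus Φ) 2 :=
    fun p ↦ singularCohomology.π ℚ ℚ _ 2 (ζ p) with hz
  haveI := finite_singularCohomology_rat_complexTorus Φ 2
  -- `cocycleOfRat` of a rational combination
  have hcomb : ∀ c : ComplexTorus.Pairs ι → ℚ,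
      singularCohomology.π ℂ ℂ _ 2 (cocycleOfRat _ 2 (∑ p, c p • ζ p)) =
        L (g • ∑ p, ((c p : ℚ) : ℂ) • ComplexTorus.coordForm Φ p.1.1 p.1.2) := fun c ↦ by
    rw [map_sum, map_sum, Finset.smul_sum, map_sum]
    refine Finset.sum_congr rfl fun p _ ↦ ?_
    rw [cocycleOfRat_smul, map_smul, hζ p, ← map_smul, smul_comm]
  have hzind : LinearIndependent ℚ z := by
    rw [Fintype.linearIndependent_iff]
    intro c hc p
    have h1 : singularCohomology.π ℚ ℚ _ 2 (∑ q, c q • ζ q) = 0 := by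
      rw [map_sum]; simpa only [map_smul] using hc
    have h2 := (π_cocycleOfRat_eq_zero_iff _).2 h1
    rw [hcomb, ← map_zero L] at h2
    have h3 : ∑ q, ((c q : ℚ) : ℂ) • ComplexTorus.coordForm Φ q.1.1 q.1.2 = 0 := by
      rcases smul_eq_zero.1 (hLinj h2) with h | h
      · exact absurd h hg0
      · exact h
    have h4 := (Fintype.linearIndependent_iff.1 (ComplexTorus.linearIndependent_coordForm Φ))
      (fun q ↦ ((c q : ℚ) : ℂ)) h3 p
    exact_mod_cast h4
  have hspan : Submodule.span ℚ (Set.range z) = ⊤ :=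
    hzind.span_eq_top_of_card_eq_finrank' (finrank_singularCohomology_rat_complexTorus_two Φ e).symm
  have hmem : singularCohomology.π ℚ ℚ _ 2 ζγ ∈ Submodule.span ℚ (Set.range z) := by
    rw [hspan]; exact Submodule.mem_top
  obtain ⟨c, hc⟩ := (Submodule.mem_span_range_iff_exists_fun ℚ).1 hmem
  refine ⟨g, ∑ p, ((c p : ℚ) : ℂ) • ComplexTorus.coordForm Φ p.1.1 p.1.2, ?_, ?_⟩
  · refine Submodule.sum_mem _ fun p _ ↦ ?_
    rw [Rat.cast_smul_eq_qsmul ℂ (c p)]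
    exact Submodule.smul_mem _ _ (Submodule.subset_span ⟨p, rfl⟩)
  · apply hLinj
    have h1 : singularCohomology.π ℚ ℚ _ 2 (∑ q, c q • ζ q) = singularCohomology.π ℚ ℚ _ 2 ζγ := by
      rw [← hc, map_sum]; simp only [map_smul, hz]
    have h2 := (π_cocycleOfRat_eq_iff _ _).2 h1
    rw [hcomb, hζγ] at h2
    rw [hLapply, ← h2]

end RationalForms

end Literature.Barriers.HodgeConjecture

end
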